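import Summits.NavierStokesRegularity.NavierStokesRegularity.Theses.PalasekTowerBreakdown
import Summits.NavierStokesRegularity.FluidComputer.PalasekTowerRegisterGlobalBudget

/-!
# NavierStokesRegularity — route `PalasekTowerBreakdown`: the line on the child crux `HeredityFromTwo`

Supports `stmt-NavierStokesRegularity-19250` (`PalasekTowerBreakdown.HeredityFromTwo :=
HeredityFrom 2`, the split child «the parent minus its first rung» of the crux
`EpisodeInduction`, planner ns-blowup-plan g17 RULING «SPLIT GO» 2026-08-26T01:59Z). Cell
`ns-blowup`, seat `ns-blowup-ecbridge-5` (g0). LABEL: E–C typing (pure glue over landed register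
theorems). WHAT THIS IS NOT: not NS — no stage, tower or instance is constructed; the child crux is
OPEN and is not claimed here; every theorem below either has it (or its halves) as hypothesis or
states an equivalence.

The planner's BC3 line on the parent decomposes the generic levels `k ≥ 2` into an UPPER half
`ContinuationEnvelope` (finite-energy classical continuation to the next readout inside the next
ceiling) and a LOWER half `ReadoutFloors` (the three floors of level `k + 1` at its readout for every
such continuation), both named in `FluidComputer/PalasekTowerRegisterGlobalHeredity.lean` (p415576).
Against the ROUTE DECL, by name:

* `palasekTowerBreakdown_heredityFromTwo_of_envelope_floors :
  ContinuationEnvelope → ReadoutFloors → PalasekTowerBreakdown.HeredityFromTwo` — the line's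
  composition concluding the child BY NAME (what a `skeleton check` of this line reads);
* `palasekTowerBreakdown_heredityFromTwo_iff_envelope_and_floors :
  PalasekTowerBreakdown.HeredityFromTwo ↔ ContinuationEnvelope ∧ ReadoutFloors` — the line is
  LOSSLESS, with NO hypothesis (`FluidComputer/PalasekTowerRegisterGlobalHalves.lean`, p419350: the
  lower half follows from the child through silent-window uniqueness, Tao 2013 Cor. 11.4 UNFORCED +
  Lemma 8.1 — tree theorems, no W14); so the two stubs are jointly EQUIVALENT to the child crux, and
  a refutation of either stub refutes the child (and the parent), not a mis-split;
* the projections `…heredityFromTwo_continuationEnvelope` / `…heredityFromTwo_readoutFloors`, the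
  `∃`-form entry `palasekTowerBreakdown_heredityFromTwo_of_envelope_exists_floors` (the lower half may
  be supplied for ONE finite-energy continuation per stage), and the parent's lossless three-way split
  `palasekTowerBreakdown_episodeInduction_iff :
  EpisodeInduction ↔ HeredityAtOne ∧ ContinuationEnvelope ∧ ReadoutFloors`.

References: S. Palasek, arXiv:2605.13827 §4 [cite: Palasek2026ElementaryModel, §4]; T. Tao, Anal.
PDE 6 (2013), Cor. 11.4, Lemma 8.1 [cite: Tao2011, Cor. 11.4].
-/

-- `Summit.<Summit>.<Problem>` is the tree's mandated summit-side namespace (CONVENTIONS §2); for this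
-- single-conjunct summit the two coincide, so the duplicate is deliberate.
set_option linter.dupNamespace false

namespace Summit.NavierStokesRegularity.NavierStokesRegularity.Theorems

open Summit.NavierStokesRegularity.NavierStokesRegularity.Theses
open Summit.NavierStokesRegularity.FluidComputer.PalasekTowerClayBridge

/-- **The line's composition, concluding the child crux BY NAME**: upper half + lower half at the
generic levels ⇒ `PalasekTowerBreakdown.HeredityFromTwo` (= `HeredityFrom 2`; register theorem
`heredityFrom_two_of_envelope_floors`). [folklore] -/
theorem palasekTowerBreakdown_heredityFromTwo_of_envelope_floors (hA : ContinuationEnvelope)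
    (hB : ReadoutFloors) : PalasekTowerBreakdown.HeredityFromTwo :=
  heredityFrom_two_of_envelope_floors hA hB

/-- **The line is lossless (no hypothesis)**: the child crux is EQUIVALENT to the conjunction of its
two halves (register theorem `heredityFrom_two_iff_envelope_and_floors`, p419350; the lower half
comes back from the child through silent-window uniqueness — Tao 2013 Cor. 11.4 unforced + Lemma
8.1, tree theorems, no W14). [folklore] -/
theorem palasekTowerBreakdown_heredityFromTwo_iff_envelope_and_floors :
    PalasekTowerBreakdown.HeredityFromTwo ↔ ContinuationEnvelope ∧ ReadoutFloors :=
  heredityFrom_two_iff_envelope_and_floors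

/-- The child crux yields the upper half (free converse, p415576). [folklore] -/
theorem palasekTowerBreakdown_heredityFromTwo_continuationEnvelope
    (h : PalasekTowerBreakdown.HeredityFromTwo) : ContinuationEnvelope :=
  ContinuationEnvelope.of_heredityFrom_two h

/-- The child crux yields the lower half (unconditionally, p419350). [folklore] -/
theorem palasekTowerBreakdown_heredityFromTwo_readoutFloors
    (h : PalasekTowerBreakdown.HeredityFromTwo) : ReadoutFloors :=
  ReadoutFloors.of_heredityFrom_two h

/-- **`∃`-form entry to the line**: the upper half together with, for every registered stage at a
generic level, ONE finite-energy classical continuation to `τ (k+1)` meeting the three floors of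
level `k + 1` (no ceiling asked of it) already gives the child crux — the floors transfer to every
finite-energy continuation by silent-window uniqueness (`ReadoutFloors.of_exists_continuation`).
[folklore] -/
theorem palasekTowerBreakdown_heredityFromTwo_of_envelope_exists_floors (hA : ContinuationEnvelope)
    (hB : ∀ S : Schedule TowerRates.wide, S.Pins 8 (6 / 5) → S.Rigid → S.Quiet → ∀ k : ℕ, 2 ≤ k →
      ∀ s : Stage 1 TowerRates.wide S (Margins.routeG TowerRates.wide) k,
      ∃ (v : ℝ → EuclideanSpace ℝ (Fin 3) → EuclideanSpace ℝ (Fin 3))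
        (q : ℝ → EuclideanSpace ℝ (Fin 3) → ℝ),
        Literature.Analysis.FluidPDE.IsClassicalNSSolutionOn (Set.Icc 0 (S.τ (k + 1))) 1 S.f v q ∧
        (∀ t ∈ Set.Icc 0 (S.τ k), v t = s.u t) ∧
        (∃ C : ENNReal, C < ⊤ ∧
          ∀ t ∈ Set.Icc 0 (S.τ (k + 1)), ∫⁻ x, ‖v t x‖ₑ ^ 2 ≤ C) ∧
        (∃ x, ‖x‖ ≤ S.radius ∧ S.c₁ * TowerRates.wide.Y (k + 1) ≤ ‖v (S.τ (k + 1)) x‖) ∧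
        (∃ x, ‖x‖ ≤ S.radius ∧
          S.c₁ * TowerRates.wide.A (k + 1) ≤ ‖fderiv ℝ (v (S.τ (k + 1))) x‖) ∧
        (∃ (x : EuclideanSpace ℝ (Fin 3)) (γ : ℝ → EuclideanSpace ℝ (Fin 3)),
          ‖x‖ ≤ S.radius ∧ ContDiff ℝ 1 γ ∧ γ 0 = γ 1 ∧
          (∀ σ ∈ Set.Icc (0 : ℝ) 1,
            γ σ ∈ Metric.closedBall x (1 / TowerRates.wide.N (k + 1))) ∧
          (∀ σ ∈ Set.Icc (0 : ℝ) 1, ‖deriv γ σ‖ ≤ 8 * Real.pi / TowerRates.wide.N (k + 1)) ∧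
          S.c₁ * TowerRates.wide.N (k + 1) ^ (TowerRates.wide.β - 2) ≤
            Literature.Analysis.FluidPDE.circulation (v (S.τ (k + 1))) γ)) :
    PalasekTowerBreakdown.HeredityFromTwo :=
  heredityFrom_two_of_envelope_floors hA (ReadoutFloors.of_exists_continuation hB)

/-- **The parent's three-way split is lossless (no hypothesis)**: the route decl
`PalasekTowerBreakdown.EpisodeInduction` (= K2G `EpisodeInductionG`) is EQUIVALENT to the first rung
`PalasekTowerBreakdown.HeredityAtOne` together with the two generic-level halves (register theorem
`episodeInductionG_iff_rung_envelope_floors`). [folklore] -/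
theorem palasekTowerBreakdown_episodeInduction_iff :
    PalasekTowerBreakdown.EpisodeInduction ↔
      PalasekTowerBreakdown.HeredityAtOne ∧ ContinuationEnvelope ∧ ReadoutFloors :=
  episodeInductionG_iff_rung_envelope_floors

/-- **Energy budget of the line** (register theorem `Stage.kineticEnergy_readout_le`, p419595): on
a quiet schedule every registered stage meets all its readouts `τ_j`, `1 ≤ j ≤ k`, with energy at
most its energy at `τ₁` — the floors the line must produce at level `k + 1` are paid for by
concentration, never by energy input. [cite: Tao2011, Lemma 8.1] -/
theorem palasekTowerBreakdown_stage_kineticEnergy_readout_le {S : Schedule TowerRates.wide}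
    (hQ : S.Quiet) {k : ℕ} (s : Stage 1 TowerRates.wide S (Margins.routeG TowerRates.wide) k)
    {j : ℕ} (hj : 1 ≤ j) (hjk : j ≤ k) :
    Literature.Analysis.FluidPDE.VectorCalculus.kineticEnergy (s.u (S.τ j)) ≤
      Literature.Analysis.FluidPDE.VectorCalculus.kineticEnergy (s.u (S.τ 1)) :=
  s.kineticEnergy_readout_le one_pos hQ hj hjk

end Summit.NavierStokesRegularity.NavierStokesRegularity.Theorems
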